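import Summits.QuantumFields.YangMills.Theorems.TwistedTraceScaling.Negative.WindowFloorOfCount
import Summits.QuantumFields.YangMills.Theorems.LuscherReductionTwistedTraceScalingStubFixedLatticeTraceLaw
import HarnessLib

/-!
# By-product of S-BASE's closure read through R74b: the capped, `β`-UNIFORM, sub-exponential LEVEL COUNT of the zero-flux transfer operator at every
# fixed lattice size `L ≥ 2` — crux disprover, cycle 61 (route `LuscherReduction`, crux `TwistedTraceScaling` stmt-QuantumFields-20203; `--supports`, helper only)

Lead g24 closed the registered stub S-BASE (✓`TwoLattice.stub_fixedLatticeTraceLaw`, p763201) through the window floor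
✓`ConstTube.windowFloor_of_valleyLog (2 ≤ L) (hV)` (W7) fed by hand w1's ✓`ConstTube.valleyGainLog_record` (R5, `a = 19/100`).  Recorded here by name:
`windowFloor_two_le (hL2 : 2 ≤ L) : W(L)` (the `hW` text, unconditional) and, through R74b's equivalence ✓`R74b.windowFloor_text_iff_count`,
★ `levelCount_two_le (hL2 : 2 ≤ L) : COUNT(L)` —

  `∀ c₁ > 0, ∃ β₀, ∀ t > 0, ∃ C, ∀ β ≥ β₀, ∀ E ∈ [0, c₁ log β], ∀ m, λ_m(β,L) > e^{−(Λ(β,L)/L)·E}·λ₀(β,L) → m + 1 ≤ C·e^{tE}`: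

the number of min–max levels of `K_β` on the physical subspace with femto energy below `E` is sub-exponential in `E`, uniformly in `β` up to the cap `c₁ log β`
(a Weyl-type bound for Wilson's `SU(2)` transfer operator on `(ℤ/L)³` in the femto regime).  No new analysis: composition of landed theorems.
HONEST FRAMING: fixed lattice size `L ≥ 2`, eventually in `β` (astronomical, `L`-dependent thresholds); a corollary of the closed stub S-BASE of a child of the
CONDITIONAL reduction route R2b1; `stub_cmpTwoLoop` and the crux `TwistedTraceScaling` OPEN; not infinite volume, not a mass gap, not Clay.
-/

set_option autoImplicit false

noncomputable section

open MeasureTheory Filter Topology Real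
open scoped BigOperators
open Literature.MathematicalPhysics.QuantumFieldTheory hiding SU2
open Literature.MathematicalPhysics.QuantumLattice
open Summit.QuantumFields.YangMills.Theorems.FemtoTransferGap

namespace Summit.QuantumFields.YangMills.Theorems.TwistedTraceScaling.Negative.R74d

variable {L : ℕ} [NeZero L]

/-- The window floor W(L) (`hW` of ✓`Base.fixedLatticeTraceLaw_of_upper_lower_window`, verbatim) holds at every `L ≥ 2`: ✓W7 at ✓R5 (`a = 19/100`). [cite: Luscher1983, §3] -/
theorem windowFloor_two_le (hL2 : 2 ≤ L) :
    ∀ c₁ : ℝ, 0 < c₁ → ∃ g : ℕ → ℝ, (∀ k, 0 ≤ g k) ∧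
      (∀ t : ℝ, 0 < t → Summable fun k : ℕ => Real.exp (-t * g k)) ∧
      ∃ β0 : ℝ, ∀ β : ℝ, β0 ≤ β → ∀ k : ℕ,
        levelValue su2Rep L β k ≤
          Real.exp (-(luscherLambda β L / L * min (g k) (c₁ * Real.log β))) * levelValue su2Rep L β 0 :=
  TwoLattice.ConstTube.windowFloor_of_valleyLog hL2
    (TwoLattice.ConstTube.valleyGainLog_record hL2 (a := 19 / 100) (by norm_num) (by norm_num))

/-- ★ **The capped `β`-uniform sub-exponential level count at every fixed `L ≥ 2`** (COUNT(L); W(L) read through ✓`R74b.windowFloor_text_iff_count`).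
[cite: ReedSimonIV1978, Thm. XIII.1] [cite: Luscher1983, §3] -/
theorem levelCount_two_le (hL2 : 2 ≤ L) :
    ∀ c₁ : ℝ, 0 < c₁ → ∃ β0 : ℝ, ∀ t : ℝ, 0 < t → ∃ C : ℝ, ∀ β : ℝ, β0 ≤ β → ∀ E : ℝ, 0 ≤ E → E ≤ c₁ * Real.log β →
      ∀ m : ℕ, Real.exp (-(luscherLambda β L / L * E)) * levelValue su2Rep L β 0 < levelValue su2Rep L β m →
        (m : ℝ) + 1 ≤ C * Real.exp (t * E) :=
  (R74b.windowFloor_text_iff_count L).1 (windowFloor_two_le hL2)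

end Summit.QuantumFields.YangMills.Theorems.TwistedTraceScaling.Negative.R74d

end
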